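import Summits.ResolutionOfSingularities.ResolutionOfSingularities.Theorems.FrobeniusClosingSteerRsopMonomialStep
import Summits.ResolutionOfSingularities.ResolutionOfSingularities.Theorems.FrobeniusClosingSteerQuadraticStepLemmas
import Summits.ResolutionOfSingularities.ResolutionOfSingularities.Theorems.FrobeniusClosingSteerDivisorTriggerTwoChart
import Literature.AlgebraicGeometry.Resolution.RsopMonomialIdeals
import Literature.AlgebraicGeometry.Resolution.RegularLocalRingsQuotient
import Literature.AlgebraicGeometry.Resolution.RegularLocalRingsProofs
import Literature.AlgebraicGeometry.Resolution.LocalBlowup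
import Literature.AlgebraicGeometry.Resolution.QuadraticTransforms
import HarnessLib

/-!
# The switch plane of a point blow-up (B13a-1 of res-L0-w41-strat-2's σ-residual HIGH half, part 1/2: chart lemmas)

W4.1, crux `Steer` (stmt-ResolutionOfSingularities-16345), σ-line at `p = 2`, §σ2.16 of the skeleton of record
(res-L0-w41-lead-1 `Steer_r24.lean`; res-L0-w41-strat-2 `R2TwoSigma-s16-strat2.delta.lean` rev 8, stub B13a-1
`switch_plane_two`, prover plan `STUBPLAN-B13.md` steps D2 + D4). Theses-free, def-free helper lemmas for ONE
local blowing up `R ⊂ R'` of a regular local subring `R ⊆ K` along its maximal ideal with respect to a valuation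
ring `O` (a quadratic transform along `O`, `R` dominated by `O`), in the chart of an exceptional parameter `π`
(an element of `𝔪_R` of maximal `O`-value), together with a second element `x ∈ 𝔪_R ∖ 𝔪_R²` whose value is
STRICTLY smaller than that of `π` (a «switch»: `x` is not an exceptional parameter):

* `isRsopPart_singleton`, `isRsopPart_pair` — one- and two-element parts of regular systems of parameters of an
  abstract regular local ring (Matsumura 14.2 bookkeeping over the tree's `IsRsopPart`);
* `valuation_lt_of_mem_sq`, `not_mem_sq_sup_span_of_valuation_lt` — valuation bookkeeping: `𝔪_R²` has values
  `< v π`, and `x ∉ 𝔪_R² + (π)` when `v x < v π`;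
* `isRsopPart_excParam_pair` — `(π, x)` is part of a regular system of parameters of `R`;
* `excParam_not_mem_sq_transform` — the exceptional parameter stays outside `𝔪_{R'}²` in the transform `R'`;
* `isRsopPart_switch_pair` — **the switch plane**: `x / π ∈ 𝔪_{R'}` and `(π, x/π)` is part of a regular system of
  parameters of `R'` (HLOST Lemma 2.7 / de Jong 2.4 in the tree: `exists_isRsopPart_quadraticTransform_rsopStep`);
* `switch_plane_quotient`, `switch_plane_quotient_dim_two` — hence `Q = (π, x/π) ⊂ R'` is prime, `R'/Q` is a
  regular local ring and `dim R'/Q + 2 = dim R'` (`= 2` when `dim R' = 4`);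
* `valuation_lt_of_not_forall_le` — the propositional reading of «`x` is no longer of maximal value».

Part 2/2 (the torsor algebra D1 + D3 of the plan: `f_{i+1} = x ρ + G₁²`, `f_{i+2} − G₃² ∈ Q²`) assembles
strat-2's `switch_plane_two` from these. No Theses file of W4.1 is imported; nothing here is a route item.
OURS (the W4.1 engine), standard commutative algebra; NOT a statement of the manuscript under review
[claim: Hironaka2017, status: under-review]. [cite: Matsumura1987, Thm. 14.2] [cite: HeinzerEtAl2015, Lemma 2.7]
[cite: DeJong1996, 2.4] [cite: NovacoskiSpivakovsky2014, Def. 2.11]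
-/

noncomputable section

-- `Summit.<S>.<S>.…` duplicates the summit name by design (single-problem summit).
set_option linter.dupNamespace false

open IsLocalRing Literature.AlgebraicGeometry.Resolution

namespace Summit.ResolutionOfSingularities.ResolutionOfSingularities.Theorems.SwitchingDichotomy.SwitchPlane

/-! ## §1 Short parts of regular systems of parameters (abstract regular local rings) -/

section Rsop

variable {A : Type*} [CommRing A]

/-- **An element of `𝔪 ∖ 𝔪²` of a regular local ring is a one-element part of a regular system of parameters**
(Matsumura 14.2: `A/(x)` is regular local of dimension `dim A − 1`, and the Remark after 14.2).
[cite: Matsumura1987, Thm. 14.2] -/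
theorem isRsopPart_singleton [IsRegularLocalRing A] {x : A} (hx : x ∈ maximalIdeal A)
    (hx2 : x ∉ maximalIdeal A ^ 2) : IsRsopPart ![x] := by
  have hr : Ideal.span (Set.range ![x]) = Ideal.span {x} := by rw [Matrix.range_cons_empty]
  obtain ⟨hreg, hdim⟩ := IsRegularLocalRing.quotient_span_singleton hx hx2
  haveI : IsRegularLocalRing (A ⧸ Ideal.span (Set.range ![x])) := by rw [hr]; exact hreg
  refine IsRsopPart.of_isRegularLocalRing_quotient (fun i => ?_) ?_
  · fin_cases i
    exact hx
  · rw [hr, Nat.cast_one]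
    exact hdim.le

/-- **Two elements `π, x ∈ 𝔪` with `π ∉ 𝔪²` and `x ∉ 𝔪² + (π)` form a part of a regular system of parameters**
of a regular local ring: `A/(π)` is regular local of dimension `dim A − 1`, the class of `x` lies in its maximal
ideal but not in the square, so `A/(π, x) ≅ (A/(π))/(x̄)` is regular local of dimension `dim A − 2`, and the
Remark after Matsumura 14.2 applies. [cite: Matsumura1987, Thm. 14.2] -/
theorem isRsopPart_pair [IsRegularLocalRing A] {π x : A} (hπ : π ∈ maximalIdeal A)
    (hπ2 : π ∉ maximalIdeal A ^ 2) (hx : x ∈ maximalIdeal A)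
    (hx2 : x ∉ maximalIdeal A ^ 2 ⊔ Ideal.span {π}) : IsRsopPart ![π, x] := by
  classical
  obtain ⟨hregI, hdimI⟩ := IsRegularLocalRing.quotient_span_singleton hπ hπ2
  haveI := hregI
  haveI : Nontrivial (A ⧸ Ideal.span {π}) :=
    Ideal.Quotient.nontrivial_iff.mpr (Ideal.span_singleton_ne_top hπ)
  -- the class of `x` in `A/(π)`
  have hxbar : Ideal.Quotient.mk (Ideal.span {π}) x ∈ maximalIdeal (A ⧸ Ideal.span {π}) := by
    rw [maximalIdeal_quotient_eq_map (Ideal.span {π})]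
    exact Ideal.mem_map_of_mem _ hx
  have hxbar2 : Ideal.Quotient.mk (Ideal.span {π}) x ∉ maximalIdeal (A ⧸ Ideal.span {π}) ^ 2 := by
    rw [maximalIdeal_quotient_eq_map (Ideal.span {π}), ← Ideal.map_pow,
      Ideal.mem_map_iff_of_surjective _ Ideal.Quotient.mk_surjective]
    rintro ⟨y, hy, hyx⟩
    rw [Ideal.Quotient.eq] at hyx
    apply hx2
    have hxy : x = y - (y - x) := by ring
    rw [hxy]
    exact Ideal.sub_mem _ (Ideal.mem_sup_left hy) (Ideal.mem_sup_right hyx)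
  obtain ⟨hreg2, hdim2⟩ := IsRegularLocalRing.quotient_span_singleton hxbar hxbar2
  haveI := hreg2
  -- `A/(π, x) ≅ (A/(π))/(x̄)`
  have hsup : Ideal.span {π} ⊔ Ideal.span {x} = Ideal.span (Set.range ![π, x]) := by
    rw [Matrix.range_cons_cons_empty, ← Ideal.span_union, Set.singleton_union]
  have hmap : (Ideal.span {x}).map (Ideal.Quotient.mk (Ideal.span {π})) =
      Ideal.span {Ideal.Quotient.mk (Ideal.span {π}) x} := by
    rw [Ideal.map_span, Set.image_singleton]
  let e : (A ⧸ Ideal.span {π}) ⧸ Ideal.span {Ideal.Quotient.mk (Ideal.span {π}) x} ≃+*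
      A ⧸ Ideal.span (Set.range ![π, x]) :=
    (Ideal.quotEquivOfEq hmap.symm).trans
      ((DoubleQuot.quotQuotEquivQuotSup (Ideal.span {π}) (Ideal.span {x})).trans
        (Ideal.quotEquivOfEq hsup))
  haveI : IsRegularLocalRing (A ⧸ Ideal.span (Set.range ![π, x])) := IsRegularLocalRing.of_ringEquiv e
  refine IsRsopPart.of_isRegularLocalRing_quotient (fun i => ?_) ?_
  · fin_cases i
    · exact hπ
    · exact hx
  · rw [← ringKrullDim_eq_of_ringEquiv e, ← hdimI, ← hdim2,
      show ((Nat.succ (Nat.succ 0) : ℕ) : WithBot ℕ∞) = 1 + 1 by norm_num, ← add_assoc]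

end Rsop

/-! ## §2 Valuation bookkeeping in a local subring dominated by `O` -/

variable {K : Type} [Field K]

/-- In a local subring `R` dominated by `O`, every element of `𝔪_R²` has value STRICTLY below the value of a
least-value element `π ≠ 0` of `𝔪_R` (`v (m n) = v m · v n ≤ v π · v n < v π`). [folklore] -/
theorem valuation_lt_of_mem_sq {O : ValuationSubring K} {R : Subring K} [IsLocalRing R]
    (hdom : SubringDominates R O.toSubring) {π : R} (hπ0 : (π : K) ≠ 0)
    (hval : ∀ y ∈ maximalIdeal R, O.valuation (y : K) ≤ O.valuation (π : K))
    {z : R} (hz : z ∈ maximalIdeal R ^ 2) : O.valuation (z : K) < O.valuation (π : K) := by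
  have hRO : R ≤ O.toSubring := hdom.1
  have hv0 : O.valuation (π : K) ≠ 0 := (map_ne_zero _).mpr hπ0
  rw [pow_two] at hz
  refine Submodule.mul_induction_on hz ?_ ?_
  · intro m hm n hn
    have hm' := hval m hm
    have hn' : O.valuation (n : K) < 1 :=
      ((subringDominates_valuationSubring_iff hRO).mp hdom n).mp hn
    calc O.valuation ((m * n : R) : K) = O.valuation (m : K) * O.valuation (n : K) := by
          push_cast
          exact map_mul _ _ _
      _ ≤ O.valuation (π : K) * O.valuation (n : K) := mul_le_mul' hm' le_rfl
      _ < O.valuation (π : K) * 1 := mul_lt_mul_of_pos_left hn' (zero_lt_iff.mpr hv0)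
      _ = O.valuation (π : K) := mul_one _
  · intro a b ha hb
    calc O.valuation ((a + b : R) : K) ≤ max (O.valuation (a : K)) (O.valuation (b : K)) := by
          push_cast
          exact Valuation.map_add _ _ _
      _ < O.valuation (π : K) := max_lt ha hb

/-- **An element of value strictly below the least value of `𝔪_R` is not in `𝔪_R² + (π)`** (unless it is in
`𝔪_R²`): if `x = m + c π` with `m ∈ 𝔪_R²` then either `c ∈ 𝔪_R` (and `x ∈ 𝔪_R²`) or `c` is a unit, and then
`v π = v (c π) = v (x − m) ≤ max (v x, v m) < v π`. [folklore] -/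
theorem not_mem_sq_sup_span_of_valuation_lt {O : ValuationSubring K} {R : Subring K} [IsLocalRing R]
    (hdom : SubringDominates R O.toSubring) {π x : R} (hπ0 : (π : K) ≠ 0) (hπ : π ∈ maximalIdeal R)
    (hval : ∀ y ∈ maximalIdeal R, O.valuation (y : K) ≤ O.valuation (π : K))
    (hx2 : x ∉ maximalIdeal R ^ 2) (hlt : O.valuation (x : K) < O.valuation (π : K)) :
    x ∉ maximalIdeal R ^ 2 ⊔ Ideal.span {π} := by
  intro h
  obtain ⟨m, hm, w, hw, hmw⟩ := Submodule.mem_sup.mp h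
  obtain ⟨c, rfl⟩ := Ideal.mem_span_singleton'.mp hw
  by_cases hc : c ∈ maximalIdeal R
  · apply hx2
    rw [← hmw, pow_two]
    exact Ideal.add_mem _ (by rw [← pow_two]; exact hm) (Ideal.mul_mem_mul hc hπ)
  · have hRO : R ≤ O.toSubring := hdom.1
    have hvc : O.valuation (c : K) = 1 := by
      have h1 : ¬ O.valuation (c : K) < 1 := fun hlt' =>
        hc (((subringDominates_valuationSubring_iff hRO).mp hdom c).mpr hlt')
      exact le_antisymm ((O.valuation_le_one_iff _).mpr (hRO c.2)) (not_lt.mp h1)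
    have hvm : O.valuation (m : K) < O.valuation (π : K) := valuation_lt_of_mem_sq hdom hπ0 hval hm
    have hcπ : ((c * π : R) : K) = (x : K) - (m : K) := by
      have h' := congrArg Subtype.val hmw
      simp only [Subring.coe_add, Subring.coe_mul] at h' ⊢
      linear_combination h'
    have h1 : O.valuation ((c * π : R) : K) = O.valuation (π : K) := by
      push_cast
      rw [map_mul, hvc, one_mul]
    have h2 : O.valuation ((x : K) - (m : K)) < O.valuation (π : K) :=
      calc O.valuation ((x : K) - (m : K)) ≤ max (O.valuation (x : K)) (O.valuation (m : K)) :=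
            Valuation.map_sub _ _ _
        _ < O.valuation (π : K) := max_lt hlt hvm
    rw [← hcπ, h1] at h2
    exact lt_irrefl _ h2

/-- The propositional reading of «`x` is NOT of maximal value on `P`» when `π` is: `v x < v π`. (With
`P = 𝔪_{R_{i+1}}` this turns the skeleton's `¬ IsExcParamAlong O (R (i+1)) (P (i+1)) x` — for `x ∈ P (i+1)`,
`x ≠ 0` — into the strict inequality used below.) [folklore] -/
theorem valuation_lt_of_not_forall_le {O : ValuationSubring K} {R : Subring K} {P : Ideal R} {π x : K}
    (hπmax : ∀ y : R, y ∈ P → O.valuation (y : K) ≤ O.valuation π)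
    (hx : ¬ ∀ y : R, y ∈ P → O.valuation (y : K) ≤ O.valuation x) :
    O.valuation x < O.valuation π := by
  push Not at hx
  obtain ⟨y, hy, hlt⟩ := hx
  exact hlt.trans_le (hπmax y hy)

/-! ## §3 `(π, x)` is part of a regular system of parameters of `R` -/

/-- **`(π, x)` is part of a regular system of parameters of `R`**: `R ⊆ K` regular local dominated by `O`,
`π ∈ 𝔪_R` non-zero of maximal value, `x ∈ R` with `x ∉ 𝔪_R²` and `v x < v π`. [cite: Matsumura1987, Thm. 14.2] -/
theorem isRsopPart_excParam_pair {O : ValuationSubring K} {R : Subring K} [IsRegularLocalRing R]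
    (hdom : SubringDominates R O.toSubring) {π x : K} (hπR : π ∈ R)
    (hπm : (⟨π, hπR⟩ : R) ∈ maximalIdeal R) (hπ0 : π ≠ 0)
    (hπmax : ∀ y : R, y ∈ maximalIdeal R → O.valuation (y : K) ≤ O.valuation π)
    (hxR : x ∈ R) (hx2 : (⟨x, hxR⟩ : R) ∉ maximalIdeal R ^ 2) (hlt : O.valuation x < O.valuation π) :
    IsRsopPart ![(⟨π, hπR⟩ : R), ⟨x, hxR⟩] := by
  have hRO : R ≤ O.toSubring := hdom.1
  have hvπ : O.valuation π < 1 :=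
    ((subringDominates_valuationSubring_iff hRO).mp hdom ⟨π, hπR⟩).mp hπm
  have hxm : (⟨x, hxR⟩ : R) ∈ maximalIdeal R :=
    QuadraticStep.mem_maximalIdeal_of_valuation_lt_one hRO _ (hlt.trans hvπ)
  have hπ2 : (⟨π, hπR⟩ : R) ∉ maximalIdeal R ^ 2 :=
    QuadraticStep.not_mem_sq_of_forall_valuation_le hdom (u₀ := ⟨π, hπR⟩) hπ0 hπmax
  exact isRsopPart_pair hπm hπ2 hxm
    (not_mem_sq_sup_span_of_valuation_lt hdom (π := ⟨π, hπR⟩) (x := ⟨x, hxR⟩) hπ0 hπm hπmax hx2 hlt)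

/-! ## §4 The exceptional parameter in the transform -/

/-- **The exceptional parameter is a regular parameter of the transform**: for the local blowing up `R ⊂ R'`
of the regular local subring `R` (dominated by `O`) along `𝔪_R` with respect to `O` and an element `π ∈ 𝔪_R`,
`π ≠ 0`, of maximal value, `π ∈ 𝔪_{R'} ∖ 𝔪_{R'}²` (HLOST Lemma 2.7 with no further quotients: `(π)` alone is
part of a regular system of parameters of `R'`). [cite: HeinzerEtAl2015, Lemma 2.7] [cite: DeJong1996, 2.4] -/
theorem excParam_not_mem_sq_transform {O : ValuationSubring K} {R R' : Subring K} [IsRegularLocalRing R]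
    (hbl : IsLocalBlowupAlong O R (maximalIdeal R) R') (hdom : SubringDominates R O.toSubring)
    {π : K} (hπR : π ∈ R) (hπm : (⟨π, hπR⟩ : R) ∈ maximalIdeal R) (hπ0 : π ≠ 0)
    (hπmax : ∀ y : R, y ∈ maximalIdeal R → O.valuation (y : K) ≤ O.valuation π) :
    ∃ (_ : IsLocalRing R') (hπ' : π ∈ R'),
      IsRsopPart ![(⟨π, hπ'⟩ : R')] ∧ (⟨π, hπ'⟩ : R') ∈ maximalIdeal R' ∧
        (⟨π, hπ'⟩ : R') ∉ maximalIdeal R' ^ 2 := by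
  classical
  have hqt : IsQuadraticTransformAlong O R R' := ⟨inferInstance, hbl⟩
  haveI : IsLocalRing R' := hqt.isLocalRing
  have hπ2 : (⟨π, hπR⟩ : R) ∉ maximalIdeal R ^ 2 :=
    QuadraticStep.not_mem_sq_of_forall_valuation_le hdom (u₀ := ⟨π, hπR⟩) hπ0 hπmax
  obtain ⟨e, xf, hd, hxf, hxfz⟩ := (isRsopPart_singleton hπm hπ2).exists_rsop
  have hxf0 : xf (Fin.castAdd e 0) = ⟨π, hπR⟩ := by rw [hxfz]; rfl
  have hi0 : ((xf (Fin.castAdd e 0) : R) : K) ≠ 0 := by rw [hxf0]; exact hπ0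
  have hmin : ∀ j, O.valuation ((xf j : R) : K) ≤ O.valuation ((xf (Fin.castAdd e 0) : R) : K) := by
    intro j
    rw [hxf0]
    exact hπmax (xf j) (by rw [← hxf]; exact Ideal.subset_span ⟨j, rfl⟩)
  let jJ : Fin 0 → {j : Fin (1 + e) // j ≠ Fin.castAdd e 0} := fun k => k.elim0
  have hjJ : Function.Injective jJ := fun a => a.elim0
  have hJ : ∀ k, O.valuation (((xf (jJ k).1 : R) : K) / ((xf (Fin.castAdd e 0) : R) : K)) < 1 :=
    fun k => k.elim0
  have hR' : R' = locAtCentre (blowupRing R ((xf (Fin.castAdd e 0) : R) : K)) O := by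
    rw [hxf0]
    exact DivisorTrigger.eq_locAtCentre_blowupRing hbl hπR hπm hπ0 hπmax
  obtain ⟨z₁, hz₁, hz₁0, -⟩ :=
    exists_isRsopPart_quadraticTransform_rsopStep R O hdom hd xf hxf (Fin.castAdd e 0) hi0 hmin
      jJ hjJ hJ R' hR'
  rw [hxf0] at hz₁0
  change ((z₁ 0 : R') : K) = π at hz₁0
  have hπ' : π ∈ R' := by rw [← hz₁0]; exact (z₁ 0).2
  have heq : (![(⟨π, hπ'⟩ : R')] : Fin 1 → R') = z₁ := by
    funext j
    fin_cases j
    exact Subtype.ext hz₁0.symm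
  refine ⟨inferInstance, hπ', ?_, ?_, ?_⟩
  · rw [heq]; exact hz₁
  · have h := hz₁.mem_maximalIdeal 0
    rwa [← heq] at h
  · have h := hz₁.not_mem_sq 0
    rwa [← heq] at h

/-! ## §5 The switch plane -/

/-- **The switch plane is a regular plane of the transform** (STUBPLAN-B13 D2 + D4). Let `R ⊆ K` be a regular
local subring dominated by `O`, `R ⊂ R'` the local blowing up along `𝔪_R` with respect to `O`, `π ∈ 𝔪_R` a
non-zero element of maximal value (an exceptional parameter: `𝔪_R R' = π R'`), and `x ∈ R` with `x ∉ 𝔪_R²`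
and `v x < v π`. Then `x / π ∈ R'` and `(π, x/π)` is part of a regular system of parameters of `R'`: complete
`(π, x)` to a regular system of parameters of `R` (`isRsopPart_excParam_pair`); `R'` is the local ring at the
centre of `O` of the `π`-chart (`eq_locAtCentre_blowupRing`); the Rees-chart theorem
(`exists_isRsopPart_quadraticTransform_rsopStep`, HLOST 2.7 / de Jong 2.4) applies to the positive-value
quotient `x / π`. [cite: HeinzerEtAl2015, Lemma 2.7] [cite: DeJong1996, 2.4] -/
theorem isRsopPart_switch_pair {O : ValuationSubring K} {R R' : Subring K} [IsRegularLocalRing R]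
    (hbl : IsLocalBlowupAlong O R (maximalIdeal R) R') (hdom : SubringDominates R O.toSubring)
    {π x : K} (hπR : π ∈ R) (hπm : (⟨π, hπR⟩ : R) ∈ maximalIdeal R) (hπ0 : π ≠ 0)
    (hπmax : ∀ y : R, y ∈ maximalIdeal R → O.valuation (y : K) ≤ O.valuation π)
    (hxR : x ∈ R) (hx2 : (⟨x, hxR⟩ : R) ∉ maximalIdeal R ^ 2) (hlt : O.valuation x < O.valuation π) :
    ∃ (_ : IsLocalRing R') (hπ' : π ∈ R') (hx' : x / π ∈ R'),
      IsRsopPart ![(⟨π, hπ'⟩ : R'), ⟨x / π, hx'⟩] := by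
  classical
  have hqt : IsQuadraticTransformAlong O R R' := ⟨inferInstance, hbl⟩
  haveI : IsLocalRing R' := hqt.isLocalRing
  have hpair := isRsopPart_excParam_pair hdom hπR hπm hπ0 hπmax hxR hx2 hlt
  obtain ⟨e, xf, hd, hxf, hxfz⟩ := hpair.exists_rsop
  have hxf0 : xf (Fin.castAdd e 0) = ⟨π, hπR⟩ := by rw [hxfz]; rfl
  have hxf1 : xf (Fin.castAdd e 1) = ⟨x, hxR⟩ := by rw [hxfz]; rfl
  have hi0 : ((xf (Fin.castAdd e 0) : R) : K) ≠ 0 := by rw [hxf0]; exact hπ0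
  have hmin : ∀ j, O.valuation ((xf j : R) : K) ≤ O.valuation ((xf (Fin.castAdd e 0) : R) : K) := by
    intro j
    rw [hxf0]
    exact hπmax (xf j) (by rw [← hxf]; exact Ideal.subset_span ⟨j, rfl⟩)
  have hne : Fin.castAdd e (1 : Fin 2) ≠ Fin.castAdd e 0 := fun h =>
    absurd (Fin.castAdd_injective _ _ h) (by decide)
  let jJ : Fin 1 → {j : Fin (2 + e) // j ≠ Fin.castAdd e 0} := fun _ => ⟨Fin.castAdd e 1, hne⟩
  have hjJ : Function.Injective jJ := fun a b _ => Subsingleton.elim a b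
  have hv0 : O.valuation π ≠ 0 := (map_ne_zero _).mpr hπ0
  have hJ : ∀ k, O.valuation (((xf (jJ k).1 : R) : K) / ((xf (Fin.castAdd e 0) : R) : K)) < 1 := by
    intro k
    change O.valuation (((xf (Fin.castAdd e 1) : R) : K) / ((xf (Fin.castAdd e 0) : R) : K)) < 1
    rw [hxf1, hxf0]
    change O.valuation (x / π) < 1
    rw [map_div₀, div_lt_one₀ (zero_lt_iff.mpr hv0)]
    exact hlt
  have hR' : R' = locAtCentre (blowupRing R ((xf (Fin.castAdd e 0) : R) : K)) O := by
    rw [hxf0]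
    exact DivisorTrigger.eq_locAtCentre_blowupRing hbl hπR hπm hπ0 hπmax
  obtain ⟨z₁, hz₁, hz₁0, hz₁k⟩ :=
    exists_isRsopPart_quadraticTransform_rsopStep R O hdom hd xf hxf (Fin.castAdd e 0) hi0 hmin
      jJ hjJ hJ R' hR'
  have hz₁1 := hz₁k 0
  rw [hxf0] at hz₁0
  change ((z₁ 0 : R') : K) = π at hz₁0
  change ((z₁ (Fin.succ 0) : R') : K) =
    ((xf (Fin.castAdd e 1) : R) : K) / ((xf (Fin.castAdd e 0) : R) : K) at hz₁1
  rw [hxf1, hxf0] at hz₁1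
  change ((z₁ 1 : R') : K) = x / π at hz₁1
  have hπ' : π ∈ R' := by rw [← hz₁0]; exact (z₁ 0).2
  have hx' : x / π ∈ R' := by rw [← hz₁1]; exact (z₁ 1).2
  refine ⟨inferInstance, hπ', hx', ?_⟩
  have heq : (![(⟨π, hπ'⟩ : R'), ⟨x / π, hx'⟩] : Fin 2 → R') = z₁ := by
    funext j
    fin_cases j
    · exact Subtype.ext hz₁0.symm
    · exact Subtype.ext hz₁1.symm
  rw [heq]
  exact hz₁

/-- **The switch plane, quotient form** (B13a-1's `Q`): under the hypotheses of `isRsopPart_switch_pair`,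
`x / π ∈ 𝔪_{R'}`, the ideal `Q = (π, x/π) ⊂ R'` is prime, `R'/Q` is a regular local ring, and
`dim R'/Q + 2 = dim R'`. [cite: Matsumura1987, Thm. 14.2] [cite: HeinzerEtAl2015, Lemma 2.7] -/
theorem switch_plane_quotient {O : ValuationSubring K} {R R' : Subring K} [IsRegularLocalRing R]
    (hbl : IsLocalBlowupAlong O R (maximalIdeal R) R') (hdom : SubringDominates R O.toSubring)
    {π x : K} (hπR : π ∈ R) (hπm : (⟨π, hπR⟩ : R) ∈ maximalIdeal R) (hπ0 : π ≠ 0)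
    (hπmax : ∀ y : R, y ∈ maximalIdeal R → O.valuation (y : K) ≤ O.valuation π)
    (hxR : x ∈ R) (hx2 : (⟨x, hxR⟩ : R) ∉ maximalIdeal R ^ 2) (hlt : O.valuation x < O.valuation π) :
    ∃ (_ : IsLocalRing R') (hπ' : π ∈ R') (hx' : x / π ∈ R'),
      (⟨x / π, hx'⟩ : R') ∈ maximalIdeal R' ∧
      (Ideal.span {(⟨π, hπ'⟩ : R'), ⟨x / π, hx'⟩}).IsPrime ∧
      IsRegularLocalRing (R' ⧸ Ideal.span {(⟨π, hπ'⟩ : R'), ⟨x / π, hx'⟩}) ∧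
      ringKrullDim (R' ⧸ Ideal.span {(⟨π, hπ'⟩ : R'), ⟨x / π, hx'⟩}) + 2 = ringKrullDim R' := by
  obtain ⟨_, hπ', hx', hz⟩ := isRsopPart_switch_pair hbl hdom hπR hπm hπ0 hπmax hxR hx2 hlt
  have hr : Ideal.span (Set.range ![(⟨π, hπ'⟩ : R'), ⟨x / π, hx'⟩]) =
      Ideal.span {(⟨π, hπ'⟩ : R'), ⟨x / π, hx'⟩} := by rw [Matrix.range_cons_cons_empty]
  refine ⟨‹_›, hπ', hx', hz.mem_maximalIdeal 1, ?_, ?_, ?_⟩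
  · have h := hz.isPrime_span_range
    rwa [hr] at h
  · have h := hz.isRegularLocalRing_quotient
    rwa [hr] at h
  · have h := hz.ringKrullDim_quotient_add
    rwa [hr, show ((Nat.succ (Nat.succ 0) : ℕ) : WithBot ℕ∞) = 2 by norm_num] at h

/-- **The switch plane in dimension four** (the shape consumed by strat-2's `switch_plane_two`, whose members
have Krull dimension `4`): `R'/(π, x/π)` is a regular local ring of dimension `2`. [cite: Matsumura1987, Thm. 14.2] -/
theorem switch_plane_quotient_dim_two {O : ValuationSubring K} {R R' : Subring K} [IsRegularLocalRing R]
    (hbl : IsLocalBlowupAlong O R (maximalIdeal R) R') (hdom : SubringDominates R O.toSubring)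
    {π x : K} (hπR : π ∈ R) (hπm : (⟨π, hπR⟩ : R) ∈ maximalIdeal R) (hπ0 : π ≠ 0)
    (hπmax : ∀ y : R, y ∈ maximalIdeal R → O.valuation (y : K) ≤ O.valuation π)
    (hxR : x ∈ R) (hx2 : (⟨x, hxR⟩ : R) ∉ maximalIdeal R ^ 2) (hlt : O.valuation x < O.valuation π)
    (hdim : ringKrullDim R' = 4) :
    ∃ (_ : IsLocalRing R') (hπ' : π ∈ R') (hx' : x / π ∈ R'),
      (⟨x / π, hx'⟩ : R') ∈ maximalIdeal R' ∧
      (Ideal.span {(⟨π, hπ'⟩ : R'), ⟨x / π, hx'⟩}).IsPrime ∧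
      IsRegularLocalRing (R' ⧸ Ideal.span {(⟨π, hπ'⟩ : R'), ⟨x / π, hx'⟩}) ∧
      ringKrullDim (R' ⧸ Ideal.span {(⟨π, hπ'⟩ : R'), ⟨x / π, hx'⟩}) = 2 := by
  obtain ⟨_, hπ', hx', hm, hprime, hreg, hd⟩ :=
    switch_plane_quotient hbl hdom hπR hπm hπ0 hπmax hxR hx2 hlt
  refine ⟨‹_›, hπ', hx', hm, hprime, hreg, ?_⟩
  haveI := hreg
  obtain ⟨n, hn⟩ := exists_nat_cast_eq_ringKrullDim
    (R := R' ⧸ Ideal.span {(⟨π, hπ'⟩ : R'), ⟨x / π, hx'⟩})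
  rw [hn, hdim] at hd
  rw [hn]
  have h4 : ((n + 2 : ℕ) : WithBot ℕ∞) = ((4 : ℕ) : WithBot ℕ∞) := by
    push_cast
    exact hd
  have hn2 : n = 2 := by
    have := Nat.cast_injective (R := WithBot ℕ∞) h4
    omega
  rw [hn2, Nat.cast_ofNat]

end Summit.ResolutionOfSingularities.ResolutionOfSingularities.Theorems.SwitchingDichotomy.SwitchPlane

end
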